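import Literature.Geometry.Riemannian.SphereGeodesics
import Literature.Geometry.Riemannian.RiemannianDistance
import Mathlib.Geometry.Manifold.Riemannian.PathELength
import Mathlib.Analysis.InnerProductSpace.Calculus
import Mathlib.Analysis.SpecialFunctions.Trigonometric.InverseDeriv
import Mathlib.Analysis.Calculus.Deriv.MeanValue
import Mathlib.MeasureTheory.Integral.IntervalIntegral.FundThmCalculus
import Mathlib.MeasureTheory.Integral.DominatedConvergence
import Mathlib.Geometry.Euclidean.Angle.Unoriented.Basic
import HarnessLib

/-!
# The Riemannian distance of the round sphere is the angle (great-circle distance)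

For the unit sphere `Sⁿ = sphere (0 : V) 1` of an `(n+1)`-dimensional real inner product space
with its Mathlib manifold structure and the tree's round metric `roundMetric V`
(`RoundSphere.lean`: the metric induced by the inclusion `ι : Sⁿ ↪ V`, an isometric immersion),
we prove that the RIEMANNIAN (length) DISTANCE — Mathlib's `Manifold.riemannianEDist` for the
norms `|v| = g_round(v, v)^{1/2}` (`(roundMetric V).riemannianBundle`), i.e. the infimum of the
lengths of `C¹` paths, = the tree's `PseudoRiemannianMetric.edist` of `RiemannianDistance.lean` —
is the great-circle distance:

  `d_{g_round}(x, y) = ∠(x, y) = arccos ⟪x, y⟫`   (`riemannianEDist_roundSphere`,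
  `edist_roundMetric`; `n ≥ 1`).

O'Neill 1983, Ch. 5, Def. 15 (Riemannian distance) with Ch. 3, p. 57 (the standard sphere as a
Riemannian submanifold); Lee, *Riemannian Manifolds* (2018), Prop. 5.27 / Ex. 6-2 (great circles
are the geodesics of the round sphere; the distance is the angle). The statement is [folklore];
the proof here is elementary and self-contained:

* UPPER BOUND (`riemannianEDist_roundSphere_le_ofReal_angle`): writing
  `y = cos θ · x + sin θ · u` with `θ = ∠(x, y)` and `u ⊥ x` a unit vector
  (`exists_eq_cos_angle_smul_add_sin_angle_smul_sphere`; `n ≥ 1` supplies `u` when `y = ± x`),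
  the great circle `t ↦ cos(θt) x + sin(θt) u` (`roundGreatCircle`) is a `C^∞` path in `Sⁿ` from
  `x` to `y` (Mathlib `ContMDiff.codRestrict_sphere`) of speed `θ`, hence of length `θ`.
* LOWER BOUND (`ofReal_angle_le_riemannianEDist_roundSphere`): for every `C¹` path the length
  dominates the angle between the endpoints. The speed of a path in `Sⁿ` for `g_round` is its
  speed in `V` (`norm_mfderiv_curve_roundSphere`, chain rule through `ι`), and for a curve `c` in
  the unit sphere of `V` the function `e(t) = ∠(c(a), c(t)) = arccos ⟪c(a), c(t)⟫` satisfies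
  `|e'| ≤ ‖c'‖` wherever `c(t) ≠ ± c(a)` (`exists_hasDerivAt_angle_abs_le`: `⟪c, c'⟫ = 0` and
  `|⟪c(a), c'⟫| ≤ ‖c'‖ √(1 − ⟪c(a), c⟫²)`), whence `∫_a^b ‖c'‖ − e` is monotone between the last
  time `e = 0` and the first later time `e = π` (`angle_le_integral_norm_deriv`, by
  `monotoneOn_of_deriv_nonneg`).

Also: the norm of tangent vectors and speeds of curves for `g_round` in ambient terms
(`norm_tangent_roundSphere`, `norm_mfderiv_curve_roundSphere`), the interval version
`ofReal_angle_le_pathELength_roundSphere`, and the existence of unit normal directions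
`exists_norm_eq_one_inner_eq_zero_sphere` (`n ≥ 1`).

Written as groundwork for the model case of `CheegerColding1997_sphereStability`
(`VolumeSphereTheoremGHDecomposition.lean`: the round sphere `0`-approximates `(Sⁿ, ∠)`), but
independent of it.

## References

* B. O'Neill, *Semi-Riemannian geometry with applications to relativity* (1983), Ch. 3, Def. 3.4
  and p. 57; Ch. 5, Def. 11, Def. 15, Prop. 18. [ONeill1983]
* J. M. Lee, *Introduction to Riemannian Manifolds*, 2nd ed. (2018), Prop. 5.27, Cor. 6.12.
  [Lee2018]
-/

noncomputable section

open Set Filter MeasureTheory InnerProductGeometry intervalIntegral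
open scoped Topology RealInnerProductSpace ENNReal Manifold ContDiff

namespace Literature.Geometry.Riemannian

section Ambient

variable {V : Type*} [NormedAddCommGroup V] [InnerProductSpace ℝ V]

/-- On a curve in the unit sphere the velocity is orthogonal to the position: if `‖c s‖ = 1`
for `s` near `t` and `c` has derivative `c'` at `t` then `⟪c t, c'⟫ = 0`. [folklore] -/
theorem inner_self_deriv_eq_zero_of_norm_eq_one {c : ℝ → V} {c' : V} {t : ℝ}
    (hc : HasDerivAt c c' t) (hnorm : ∀ᶠ s in 𝓝 t, ‖c s‖ = 1) : ⟪c t, c'⟫ = 0 := by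
  have h1 : HasDerivAt (fun s ↦ ⟪c s, c s⟫) (⟪c t, c'⟫ + ⟪c', c t⟫) t := hc.inner ℝ hc
  have h2 : HasDerivAt (fun s ↦ ⟪c s, c s⟫) 0 t := by
    refine (hasDerivAt_const t (1 : ℝ)).congr_of_eventuallyEq ?_
    filter_upwards [hnorm] with s hs
    rw [real_inner_self_eq_norm_sq, hs, one_pow]
  have h := h1.unique h2
  have h3 : ⟪c', c t⟫ = ⟪c t, c'⟫ := real_inner_comm _ _
  linarith

/-- The key pointwise estimate: for unit vectors `c₀, p` and any `q` orthogonal to `p`,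
`|⟪c₀, q⟫| ≤ ‖q‖ √(1 − ⟪c₀, p⟫²)` (decompose `c₀ = ⟪c₀, p⟫ p + w`, `w ⊥ p`, `‖w‖² = 1 − ⟪c₀, p⟫²`).
[folklore] -/
theorem abs_inner_le_norm_mul_sqrt {c₀ p q : V} (h₀ : ‖c₀‖ = 1) (hp : ‖p‖ = 1)
    (hpq : ⟪p, q⟫ = 0) : |⟪c₀, q⟫| ≤ ‖q‖ * Real.sqrt (1 - ⟪c₀, p⟫ ^ 2) := by
  set a : ℝ := ⟪c₀, p⟫ with ha
  set w : V := c₀ - a • p with hw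
  have hwq : ⟪c₀, q⟫ = ⟪w, q⟫ := by
    rw [hw, inner_sub_left, real_inner_smul_left, hpq, mul_zero, sub_zero]
  have hwn : ‖w‖ ^ 2 = 1 - a ^ 2 := by
    rw [hw, @norm_sub_sq_real, h₀, norm_smul, hp, mul_one, real_inner_smul_right, ← ha,
      Real.norm_eq_abs, sq_abs]
    ring
  have hwnorm : ‖w‖ = Real.sqrt (1 - a ^ 2) := by
    rw [← hwn, Real.sqrt_sq (norm_nonneg _)]
  rw [hwq, ← hwnorm, mul_comm]
  exact abs_real_inner_le_norm w q

/-- **Derivative of the angle along a curve in the unit sphere.** If `‖c s‖ = 1` near `t`, `c` has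
derivative `c'` at `t`, `‖c₀‖ = 1` and `c t ≠ ± c₀`, then `s ↦ ∠(c₀, c s)` has a derivative `e'`
at `t` with `|e'| ≤ ‖c'‖` (`e = arccos ⟪c₀, c⟫`, `e' = −⟪c₀, c'⟫/√(1 − ⟪c₀, c t⟫²)` and the
previous estimate with `⟪c t, c'⟫ = 0`). [folklore] -/
theorem exists_hasDerivAt_angle_abs_le {c : ℝ → V} {c' c₀ : V} {t : ℝ}
    (hc : HasDerivAt c c' t) (hnorm : ∀ᶠ s in 𝓝 t, ‖c s‖ = 1) (h₀ : ‖c₀‖ = 1)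
    (hne : c t ≠ c₀) (hne' : c t ≠ -c₀) :
    ∃ e' : ℝ, HasDerivAt (fun s ↦ angle c₀ (c s)) e' t ∧ |e'| ≤ ‖c'‖ := by
  have hct : ‖c t‖ = 1 := hnorm.self_of_nhds
  -- the inner product `φ = ⟪c₀, c⟫` and its derivative
  have hφ : HasDerivAt (fun s ↦ ⟪c₀, c s⟫) ⟪c₀, c'⟫ t := by
    have := (hasDerivAt_const t c₀).inner ℝ hc
    simpa using this
  have hφ1 : ⟪c₀, c t⟫ ≠ 1 := fun h ↦ hne ((inner_eq_one_iff_of_norm_eq_one h₀ hct).1 h).symm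
  have hφ2 : ⟪c₀, c t⟫ ≠ -1 := fun h ↦ hne' (by
    have := (inner_eq_neg_one_iff_of_norm_eq_one h₀ hct).1 h
    rw [this, neg_neg])
  -- `e = arccos ∘ φ` near `t`
  have heq : (fun s ↦ angle c₀ (c s)) =ᶠ[𝓝 t] fun s ↦ Real.arccos ⟪c₀, c s⟫ := by
    filter_upwards [hnorm] with s hs
    simp only [angle, h₀, hs, mul_one, div_one]
  have harccos := Real.hasDerivAt_arccos hφ2 hφ1
  have he := harccos.comp t hφ
  refine ⟨_, he.congr_of_eventuallyEq heq, ?_⟩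
  -- the estimate
  have hperp : ⟪c t, c'⟫ = 0 := inner_self_deriv_eq_zero_of_norm_eq_one hc hnorm
  have hkey := abs_inner_le_norm_mul_sqrt (q := c') h₀ hct hperp
  have hlt : ⟪c₀, c t⟫ ^ 2 < 1 := by
    have hle : |⟪c₀, c t⟫| ≤ 1 := by
      have := abs_real_inner_le_norm c₀ (c t)
      rwa [h₀, hct, one_mul] at this
    have hne1 : |⟪c₀, c t⟫| ≠ 1 := by
      intro h
      rcases abs_eq (zero_le_one) |>.1 h with h' | h'
      · exact hφ1 h'
      · exact hφ2 h'
    have : |⟪c₀, c t⟫| < 1 := lt_of_le_of_ne hle hne1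
    have h2 : |⟪c₀, c t⟫| ^ 2 < 1 := by nlinarith [abs_nonneg ⟪c₀, c t⟫]
    rwa [sq_abs] at h2
  have hpos : 0 < Real.sqrt (1 - ⟪c₀, c t⟫ ^ 2) := Real.sqrt_pos.2 (by linarith)
  rw [abs_mul, abs_neg, abs_div, abs_one, abs_of_pos hpos, one_div, inv_mul_le_iff₀ hpos]
  calc |⟪c₀, c'⟫| ≤ ‖c'‖ * Real.sqrt (1 - ⟪c₀, c t⟫ ^ 2) := hkey
    _ = Real.sqrt (1 - ⟪c₀, c t⟫ ^ 2) * ‖c'‖ := mul_comm _ _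

/-- **Arc ≥ angle.** For a curve `c` in the unit sphere of `V` (`‖c‖ = 1` on `[a, b]`),
continuous on `[a, b]`, with a derivative `c' t` at every interior point and `c'` continuous on
`[a, b]`: `∠(c a, c b) ≤ ∫_a^b ‖c'‖`. Proof: with `t₀` the last time at which `c = c a` and `t₁`
the first later time at which `c = −c a` (or `b`), the function `∫_a^t ‖c'‖ − ∠(c a, c t)` is
continuous on `[t₀, t₁]` and has nonnegative derivative inside
(`exists_hasDerivAt_angle_abs_le`), hence is monotone. [folklore] -/
theorem angle_le_integral_norm_deriv {c c' : ℝ → V} {a b : ℝ} (hab : a ≤ b)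
    (hc : ContinuousOn c (Icc a b)) (hc' : ContinuousOn c' (Icc a b))
    (hder : ∀ t ∈ Ioo a b, HasDerivAt c (c' t) t) (hnorm : ∀ t ∈ Icc a b, ‖c t‖ = 1) :
    angle (c a) (c b) ≤ ∫ t in a..b, ‖c' t‖ := by
  -- preliminaries on the integrand
  have hn' : ContinuousOn (fun t ↦ ‖c' t‖) (Icc a b) := hc'.norm
  have hint : ∀ {s u : ℝ}, s ∈ Icc a b → u ∈ Icc a b →
      IntervalIntegrable (fun t ↦ ‖c' t‖) volume s u :=
    fun hs hu ↦ (hn'.mono (uIcc_subset_Icc hs hu)).intervalIntegrable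
  have hnonneg : ∀ {s u : ℝ}, s ≤ u → 0 ≤ ∫ t in s..u, ‖c' t‖ := fun hsu ↦
    intervalIntegral.integral_nonneg hsu fun t _ ↦ norm_nonneg _
  have ha : a ∈ Icc a b := left_mem_Icc.2 hab
  have hb : b ∈ Icc a b := right_mem_Icc.2 hab
  have h₀ : ‖c a‖ = 1 := hnorm a ha
  have hc₀ne : c a ≠ 0 := by
    intro h; rw [h, norm_zero] at h₀; exact zero_ne_one h₀
  -- the last time `t₀` at which `c = c a`
  have hS₀closed : IsClosed (Icc a b ∩ c ⁻¹' {c a}) :=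
    hc.preimage_isClosed_of_isClosed isClosed_Icc isClosed_singleton
  have haS₀ : a ∈ Icc a b ∩ c ⁻¹' {c a} := ⟨ha, rfl⟩
  have hS₀bdd : BddAbove (Icc a b ∩ c ⁻¹' {c a}) := ⟨b, fun t ht ↦ ht.1.2⟩
  obtain ⟨t₀, hat₀, ht₀b, hct₀, hafter⟩ : ∃ t₀, a ≤ t₀ ∧ t₀ ≤ b ∧ c t₀ = c a ∧
      ∀ t ∈ Icc a b, t₀ < t → c t ≠ c a := by
    have hmem := hS₀closed.csSup_mem ⟨a, haS₀⟩ hS₀bdd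
    exact ⟨sSup (Icc a b ∩ c ⁻¹' {c a}), le_csSup hS₀bdd haS₀, hmem.1.2, hmem.2,
      fun t ht hlt heq ↦ (not_le.2 hlt) (le_csSup hS₀bdd ⟨ht, heq⟩)⟩
  -- trivial case `t₀ = b`
  rcases eq_or_lt_of_le ht₀b with h | ht₀b'
  · have : c b = c a := h ▸ hct₀
    rw [this, angle_self hc₀ne]
    exact hnonneg hab
  -- the first time `t₁ > t₀` at which `c = -c a`, or `b`
  have hS₁closed : IsClosed (Icc t₀ b ∩ c ⁻¹' {-c a}) :=
    (hc.mono (Icc_subset_Icc hat₀ le_rfl)).preimage_isClosed_of_isClosed isClosed_Icc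
      isClosed_singleton
  have hS₁bdd : BddBelow (Icc t₀ b ∩ c ⁻¹' {-c a}) := ⟨t₀, fun t ht ↦ ht.1.1⟩
  obtain ⟨t₁, ht₀t₁, ht₁b, hbetween, hend⟩ : ∃ t₁, t₀ < t₁ ∧ t₁ ≤ b ∧
      (∀ t ∈ Ioo t₀ t₁, c t ≠ -c a) ∧ (c t₁ = -c a ∨ t₁ = b) := by
    by_cases hS₁ : (Icc t₀ b ∩ c ⁻¹' {-c a}).Nonempty
    · have hmem := hS₁closed.csInf_mem hS₁ hS₁bdd
      have hge : t₀ ≤ sInf (Icc t₀ b ∩ c ⁻¹' {-c a}) := hmem.1.1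
      have hcval : c (sInf (Icc t₀ b ∩ c ⁻¹' {-c a})) = -c a := hmem.2
      have hgt : t₀ < sInf (Icc t₀ b ∩ c ⁻¹' {-c a}) := by
        rcases eq_or_lt_of_le hge with h | h
        · exfalso
          apply hc₀ne
          have h1 : c a = -c a := by
            have := hcval
            rwa [← h, hct₀] at this
          have h2 : (2 : ℝ) • c a = 0 := by
            rw [two_smul]
            nth_rw 2 [h1]
            exact add_neg_cancel (c a)
          exact (smul_eq_zero.1 h2).resolve_left two_ne_zero
        · exact h
      refine ⟨_, hgt, hmem.1.2, fun t ht heq ↦ ?_, Or.inl hcval⟩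
      have htS₁ : t ∈ Icc t₀ b ∩ c ⁻¹' {-c a} := ⟨⟨ht.1.le, ht.2.le.trans hmem.1.2⟩, heq⟩
      exact (not_lt.2 (csInf_le hS₁bdd htS₁)) ht.2
    · exact ⟨b, ht₀b', le_rfl, fun t ht heq ↦ hS₁ ⟨t, ⟨ht.1.le, ht.2.le⟩, heq⟩, Or.inr rfl⟩
  -- on `(t₀, t₁)` the curve avoids `± c a`
  have hIcc_sub : Icc t₀ t₁ ⊆ Icc a b := Icc_subset_Icc hat₀ ht₁b
  have hIoo_sub : Ioo t₀ t₁ ⊆ Ioo a b := Ioo_subset_Ioo hat₀ ht₁b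
  have havoid : ∀ t ∈ Ioo t₀ t₁, c t ≠ c a ∧ c t ≠ -c a := fun t ht ↦
    ⟨hafter t (Ioo_subset_Icc_self (hIoo_sub ht)) ht.1, hbetween t ht⟩
  -- derivatives of `L = ∫_a^· ‖c'‖` and `e = ∠(c a, c ·)` inside
  have hderiv_L : ∀ t ∈ Ioo t₀ t₁,
      HasDerivAt (fun u ↦ ∫ s in a..u, ‖c' s‖) (‖c' t‖) t := fun t ht ↦ by
    have ht' : t ∈ Ioo a b := hIoo_sub ht
    have hnhds : Icc a b ∈ 𝓝 t := Icc_mem_nhds ht'.1 ht'.2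
    refine intervalIntegral.integral_hasDerivAt_right (hint ha ⟨ht'.1.le, ht'.2.le⟩) ?_ ?_
    · exact (hn'.mono Ioo_subset_Icc_self).stronglyMeasurableAtFilter isOpen_Ioo t ht'
    · exact hn'.continuousAt hnhds
  have hderiv_e : ∀ t ∈ Ioo t₀ t₁, ∃ e' : ℝ,
      HasDerivAt (fun s ↦ angle (c a) (c s)) e' t ∧ |e'| ≤ ‖c' t‖ := fun t ht ↦ by
    have ht' : t ∈ Ioo a b := hIoo_sub ht
    have hnhds : Icc a b ∈ 𝓝 t := Icc_mem_nhds ht'.1 ht'.2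
    have hev : ∀ᶠ s in 𝓝 t, ‖c s‖ = 1 := eventually_of_mem hnhds hnorm
    exact exists_hasDerivAt_angle_abs_le (hder t ht') hev h₀ (havoid t ht).1 (havoid t ht).2
  -- `L - e` is monotone on `[t₀, t₁]`
  have hmono : MonotoneOn (fun t ↦ (∫ s in a..t, ‖c' s‖) - angle (c a) (c t)) (Icc t₀ t₁) := by
    apply monotoneOn_of_deriv_nonneg (convex_Icc t₀ t₁)
    · apply ContinuousOn.sub
      · have hL := intervalIntegral.continuousOn_primitive_interval' (hint ha hb)
          (left_mem_uIcc (a := a) (b := b))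
        rw [uIcc_of_le hab] at hL
        exact hL.mono hIcc_sub
      · intro t ht
        have hct : c t ≠ 0 := by
          intro h; have := hnorm t (hIcc_sub ht); rw [h, norm_zero] at this
          exact zero_ne_one this
        have hA : ContinuousAt (fun y : V × V ↦ angle y.1 y.2) (c a, c t) :=
          continuousAt_angle hc₀ne hct
        have hB : ContinuousWithinAt (fun s ↦ (c a, c s)) (Icc t₀ t₁) t :=
          continuousWithinAt_const.prodMk (hc.mono hIcc_sub t ht)
        exact ContinuousAt.comp_continuousWithinAt (f := fun s ↦ (c a, c s)) (x := t) hA hB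
    · rw [interior_Icc]
      intro t ht
      obtain ⟨e', he', -⟩ := hderiv_e t ht
      exact ((hderiv_L t ht).sub he').differentiableAt.differentiableWithinAt
    · rw [interior_Icc]
      intro t ht
      obtain ⟨e', he', hle⟩ := hderiv_e t ht
      have hd : HasDerivAt (fun u ↦ (∫ s in a..u, ‖c' s‖) - angle (c a) (c u)) (‖c' t‖ - e') t :=
        (hderiv_L t ht).sub he'
      rw [hd.deriv]
      linarith [le_abs_self e']
  -- conclusion
  have hfin := hmono (left_mem_Icc.2 ht₀t₁.le) (right_mem_Icc.2 ht₀t₁.le) ht₀t₁.le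
  simp only at hfin
  have he₀ : angle (c a) (c t₀) = 0 := by rw [hct₀, angle_self hc₀ne]
  have hLt₀ : 0 ≤ ∫ s in a..t₀, ‖c' s‖ := hnonneg hat₀
  have ht₁mem : t₁ ∈ Icc a b := ⟨hat₀.trans ht₀t₁.le, ht₁b⟩
  have hLt₁ : (∫ s in a..t₁, ‖c' s‖) ≤ ∫ t in a..b, ‖c' t‖ := by
    have := intervalIntegral.integral_add_adjacent_intervals (hint ha ht₁mem) (hint ht₁mem hb)
    linarith [hnonneg ht₁b]
  have he₁ : angle (c a) (c t₁) ≤ ∫ t in a..b, ‖c' t‖ := by linarith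
  rcases hend with h | h
  · calc angle (c a) (c b) ≤ Real.pi := angle_le_pi _ _
      _ = angle (c a) (c t₁) := by rw [h, angle_self_neg_of_nonzero hc₀ne]
      _ ≤ _ := he₁
  · rwa [h] at he₁

end Ambient

/-! ### Great circles -/

section GreatCircle

variable {V : Type*} [NormedAddCommGroup V] [InnerProductSpace ℝ V]

/-- The great circle `t ↦ cos(θt) x + sin(θt) u` through `x` in the direction `u`, at angular
speed `θ`. [folklore] -/
def roundGreatCircle (x u : V) (θ : ℝ) (t : ℝ) : V :=
  Real.cos (θ * t) • x + Real.sin (θ * t) • u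

/-- A great circle of the unit sphere stays on the unit sphere (`x, u` orthonormal). [folklore] -/
theorem norm_roundGreatCircle {x u : V} (hx : ‖x‖ = 1) (hu : ‖u‖ = 1) (hxu : ⟪x, u⟫ = 0) (θ t : ℝ) :
    ‖roundGreatCircle x u θ t‖ = 1 := by
  have h := norm_sq_smul_add_smul hx hu hxu (Real.cos (θ * t)) (Real.sin (θ * t))
  rw [Real.cos_sq_add_sin_sq] at h
  have h0 : 0 ≤ ‖roundGreatCircle x u θ t‖ := norm_nonneg _
  unfold roundGreatCircle at *
  nlinarith [h, h0]

/-- The velocity of the great circle. [folklore] -/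
theorem hasDerivAt_roundGreatCircle (x u : V) (θ t : ℝ) :
    HasDerivAt (roundGreatCircle x u θ)
      ((-(Real.sin (θ * t) * θ)) • x + (Real.cos (θ * t) * θ) • u) t := by
  unfold roundGreatCircle
  have h1 : HasDerivAt (fun s ↦ Real.cos (θ * s)) (-(Real.sin (θ * t) * θ)) t := by
    simpa using ((hasDerivAt_id t).const_mul θ).cos
  have h2 : HasDerivAt (fun s ↦ Real.sin (θ * s)) (Real.cos (θ * t) * θ) t := by
    simpa using ((hasDerivAt_id t).const_mul θ).sin
  exact (h1.smul_const x).add (h2.smul_const u)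

/-- The great circle is smooth. [folklore] -/
theorem contDiff_roundGreatCircle (x u : V) (θ : ℝ) {m : ℕ∞ω} : ContDiff ℝ m (roundGreatCircle x u θ) := by
  unfold roundGreatCircle
  fun_prop

/-- The speed of the great circle is `θ` (`θ ≥ 0`, `x, u` orthonormal). [folklore] -/
theorem norm_deriv_roundGreatCircle {x u : V} (hx : ‖x‖ = 1) (hu : ‖u‖ = 1) (hxu : ⟪x, u⟫ = 0)
    {θ : ℝ} (hθ : 0 ≤ θ) (t : ℝ) : ‖deriv (roundGreatCircle x u θ) t‖ = θ := by
  rw [(hasDerivAt_roundGreatCircle x u θ t).deriv]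
  have h := norm_sq_smul_add_smul hx hu hxu (-(Real.sin (θ * t) * θ))
    (Real.cos (θ * t) * θ)
  have h2 : (-(Real.sin (θ * t) * θ)) ^ 2 + (Real.cos (θ * t) * θ) ^ 2 = θ ^ 2 := by
    nlinarith [Real.cos_sq_add_sin_sq (θ * t)]
  rw [h2] at h
  have h0 : 0 ≤ ‖(-(Real.sin (θ * t) * θ)) • x + (Real.cos (θ * t) * θ) • u‖ := norm_nonneg _
  nlinarith [h, h0, hθ]

/-- `roundGreatCircle x u θ 0 = x`. [folklore] -/
@[simp] theorem roundGreatCircle_zero (x u : V) (θ : ℝ) : roundGreatCircle x u θ 0 = x := by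
  simp [roundGreatCircle]

/-- `roundGreatCircle x u θ 1 = cos θ • x + sin θ • u`. [folklore] -/
@[simp] theorem roundGreatCircle_one (x u : V) (θ : ℝ) :
    roundGreatCircle x u θ 1 = Real.cos θ • x + Real.sin θ • u := by
  simp [roundGreatCircle]

end GreatCircle

/-! ### The round sphere: tangent norms, velocities, and the two bounds -/

section RoundSphere

open Lorentzian Lorentzian.PseudoRiemannianMetric Manifold Bundle Metric Module

variable {V : Type*} [NormedAddCommGroup V] [InnerProductSpace ℝ V] {n : ℕ}
  [Fact (finrank ℝ V = n + 1)]

/-- **Norms of tangent vectors of the round sphere**: in the Riemannian bundle structure of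
`g_round` (`(roundMetric V).riemannianBundle`), `‖w‖ = ‖dι_y w‖` — the inclusion is an isometric
immersion. [cite: ONeill1983, Ch. 3, Def. 3.4 and p. 57] -/
theorem norm_tangent_roundSphere (y : sphere (0 : V) 1) (w : TangentSpace (𝓡 n) y) :
    letI := (roundMetric (n := n) V).riemannianBundle isRiemannian_roundMetric
    ‖w‖ = ‖(mfderiv (𝓡 n) 𝓘(ℝ, V) (Subtype.val : sphere (0 : V) 1 → V) y w : V)‖ := by
  letI := (roundMetric (n := n) V).riemannianBundle isRiemannian_roundMetric
  rw [(roundMetric (n := n) V).norm_eq_sqrt isRiemannian_roundMetric y w, roundMetric_apply_self,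
    Real.sqrt_sq (norm_nonneg _)]

/-- **Speed of a curve on the round sphere** = speed of the curve in the ambient space: for
`γ : ℝ → Sⁿ` differentiable at `t`, `‖γ'(t)‖_{g_round} = ‖(ι ∘ γ)'(t)‖`. [folklore] -/
theorem norm_mfderiv_curve_roundSphere {γ : ℝ → sphere (0 : V) 1} {t : ℝ}
    (hγ : MDifferentiableAt 𝓘(ℝ, ℝ) (𝓡 n) γ t) :
    letI := (roundMetric (n := n) V).riemannianBundle isRiemannian_roundMetric
    ‖mfderiv 𝓘(ℝ, ℝ) (𝓡 n) γ t 1‖ = ‖deriv (fun s ↦ (γ s : V)) t‖ := by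
  letI := (roundMetric (n := n) V).riemannianBundle isRiemannian_roundMetric
  rw [norm_tangent_roundSphere, norm_tangentSpace_vectorSpace]
  have hval : MDifferentiableAt (𝓡 n) 𝓘(ℝ, V) (Subtype.val : sphere (0 : V) 1 → V) (γ t) :=
    (contMDiff_coe_sphere (m := 1) (γ t)).mdifferentiableAt one_ne_zero
  have hcomp := mfderiv_comp t hval hγ
  have h1 : (mfderiv (𝓡 n) 𝓘(ℝ, V) (Subtype.val : sphere (0 : V) 1 → V) (γ t)
      (mfderiv 𝓘(ℝ, ℝ) (𝓡 n) γ t 1) : V) =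
      (mfderiv 𝓘(ℝ, ℝ) 𝓘(ℝ, V) ((Subtype.val : sphere (0 : V) 1 → V) ∘ γ) t 1 : V) := by
    rw [hcomp]; rfl
  have h2 : mfderiv 𝓘(ℝ, ℝ) 𝓘(ℝ, V) ((Subtype.val : sphere (0 : V) 1 → V) ∘ γ) t 1 =
      deriv (fun s ↦ (γ s : V)) t := by
    rw [mfderiv_eq_fderiv]; rfl
  exact congrArg norm (h1.trans h2)

/-- **Arc ≥ angle on the round sphere, for paths on an interval**: for `γ : ℝ → Sⁿ` of class `C¹`
on `[a, b]`, `∠(γ a, γ b) ≤ L(γ|[a, b])` (the length for `g_round`). From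
`angle_le_integral_norm_deriv` for `ι ∘ γ` and `norm_mfderiv_curve_roundSphere`. [folklore] -/
theorem ofReal_angle_le_pathELength_roundSphere {γ : ℝ → sphere (0 : V) 1} {a b : ℝ}
    (hab : a ≤ b) (hγ : ContMDiffOn 𝓘(ℝ, ℝ) (𝓡 n) 1 γ (Icc a b)) :
    letI := (roundMetric (n := n) V).riemannianBundle isRiemannian_roundMetric
    ENNReal.ofReal (angle (γ a : V) (γ b)) ≤ pathELength (𝓡 n) γ a b := by
  letI := (roundMetric (n := n) V).riemannianBundle isRiemannian_roundMetric
  rcases eq_or_lt_of_le hab with rfl | hab'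
  · have : angle (γ a : V) (γ a) = 0 :=
      angle_self (by simpa using ne_zero_of_mem_unit_sphere (γ a))
    simp [this]
  -- the ambient curve and its derivative within `[a, b]`
  set c : ℝ → V := fun s ↦ (γ s : V) with hc
  have hcS : ContMDiffOn 𝓘(ℝ, ℝ) 𝓘(ℝ, V) 1 c (Icc a b) :=
    contMDiff_coe_sphere.comp_contMDiffOn hγ
  have hcD : ContDiffOn ℝ 1 c (Icc a b) := contMDiffOn_iff_contDiffOn.1 hcS
  set c' : ℝ → V := derivWithin c (Icc a b) with hc'
  have hc'cont : ContinuousOn c' (Icc a b) :=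
    hcD.continuousOn_derivWithin (uniqueDiffOn_Icc hab') le_rfl
  have hder : ∀ t ∈ Ioo a b, HasDerivAt c (c' t) t := fun t ht ↦ by
    have hnhds : Icc a b ∈ 𝓝 t := Icc_mem_nhds ht.1 ht.2
    have hd : DifferentiableAt ℝ c t :=
      (hcD.differentiableOn one_ne_zero t (Ioo_subset_Icc_self ht)).differentiableAt hnhds
    rw [hc', derivWithin_of_mem_nhds hnhds]
    exact hd.hasDerivAt
  have hnorm : ∀ t ∈ Icc a b, ‖c t‖ = 1 := fun t _ ↦ by simp [c]
  have hA := angle_le_integral_norm_deriv hab hcD.continuousOn hc'cont hder hnorm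
  -- the length as a real integral
  have hγdiff : ∀ t ∈ Ioo a b, MDifferentiableAt 𝓘(ℝ, ℝ) (𝓡 n) γ t := fun t ht ↦
    ((hγ t (Ioo_subset_Icc_self ht)).mdifferentiableWithinAt one_ne_zero).mdifferentiableAt
      (Icc_mem_nhds ht.1 ht.2)
  rw [pathELength_eq_lintegral_mfderiv_Ioo]
  have hcongr : ∫⁻ t in Ioo a b, ‖mfderiv 𝓘(ℝ, ℝ) (𝓡 n) γ t 1‖ₑ =
      ∫⁻ t in Ioo a b, ENNReal.ofReal ‖c' t‖ := by
    refine setLIntegral_congr_fun measurableSet_Ioo fun t ht ↦ ?_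
    rw [← ofReal_norm, norm_mfderiv_curve_roundSphere (hγdiff t ht),
      (hder t ht).deriv]
  have hint : IntegrableOn (fun t ↦ ‖c' t‖) (Ioo a b) :=
    (hc'cont.norm.integrableOn_Icc (μ := volume)).mono_set Ioo_subset_Icc_self
  rw [hcongr, ← ofReal_integral_eq_lintegral_ofReal hint
    (ae_of_all _ fun t ↦ norm_nonneg (c' t))]
  refine ENNReal.ofReal_le_ofReal (hA.trans_eq ?_)
  rw [intervalIntegral.integral_of_le hab, integral_Ioc_eq_integral_Ioo]

/-- **Arc ≥ angle on the round sphere**: `∠(x, y) ≤ d_{g_round}(x, y)`, the Riemannian distance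
of the round metric (infimum of lengths of `C¹` paths) is at least the angle.
[cite: ONeill1983, Ch. 5, Def. 15 and Ch. 3, p. 57] -/
theorem ofReal_angle_le_riemannianEDist_roundSphere (x y : sphere (0 : V) 1) :
    letI := (roundMetric (n := n) V).riemannianBundle isRiemannian_roundMetric
    ENNReal.ofReal (angle (x : V) y) ≤ riemannianEDist (𝓡 n) x y := by
  letI := (roundMetric (n := n) V).riemannianBundle isRiemannian_roundMetric
  rw [riemannianEDist]
  refine le_iInf₂ fun γ hγ ↦ ?_
  rw [lintegral_norm_mfderiv_Icc_eq_pathELength_projIcc (I := 𝓡 n) (γ := γ)]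
  have hγ' : ContMDiffOn 𝓘(ℝ, ℝ) (𝓡 n) 1 (γ ∘ projIcc 0 1 zero_le_one) (Icc 0 1) :=
    contMDiffOn_comp_projIcc_iff.2 hγ
  have h := ofReal_angle_le_pathELength_roundSphere (n := n) zero_le_one hγ'
  have h0 : (γ ∘ projIcc 0 1 zero_le_one) 0 = x := by
    simp [projIcc_left, Icc.mk_zero]
  have h1 : (γ ∘ projIcc 0 1 zero_le_one) 1 = y := by
    simp [projIcc_right, Icc.mk_one]
  rw [h0, h1] at h
  exact h

/-- In dimension `n ≥ 1` every point of the sphere has a unit vector orthogonal to it. [folklore] -/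
theorem exists_norm_eq_one_inner_eq_zero_sphere (hn : 1 ≤ n) (x : sphere (0 : V) 1) :
    ∃ u : V, ‖u‖ = 1 ∧ ⟪(x : V), u⟫ = 0 := by
  haveI : FiniteDimensional ℝ V := .of_fact_finrank_eq_succ n
  have hx0 : (x : V) ≠ 0 := ne_zero_of_mem_unit_sphere x
  have hrank : finrank ℝ (ℝ ∙ (x : V))ᗮ = n := Submodule.finrank_orthogonal_span_singleton hx0
  have hpos : 0 < finrank ℝ (ℝ ∙ (x : V))ᗮ := by omega
  obtain ⟨w, hw⟩ := Module.finrank_pos_iff_exists_ne_zero.1 hpos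
  have hw0 : (w : V) ≠ 0 := fun h ↦ hw (Subtype.ext h)
  have hxw : ⟪(x : V), w⟫ = 0 := Submodule.mem_orthogonal_singleton_iff_inner_right.1 w.2
  refine ⟨‖(w : V)‖⁻¹ • (w : V), ?_, ?_⟩
  · rw [norm_smul, norm_inv, norm_norm, inv_mul_cancel₀ (norm_ne_zero_iff.2 hw0)]
  · rw [real_inner_smul_right, hxw, mul_zero]

/-- **Orthonormal decomposition along the angle**: `y = cos ∠(x,y) • x + sin ∠(x,y) • u` for some
unit `u ⊥ x` (`n ≥ 1` is used when `y = ± x`). [folklore] -/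
theorem exists_eq_cos_angle_smul_add_sin_angle_smul_sphere (hn : 1 ≤ n) (x y : sphere (0 : V) 1) :
    ∃ u : V, ‖u‖ = 1 ∧ ⟪(x : V), u⟫ = 0 ∧
      (y : V) = Real.cos (angle (x : V) y) • (x : V) + Real.sin (angle (x : V) y) • u := by
  have hx : ‖(x : V)‖ = 1 := by simp
  have hy : ‖(y : V)‖ = 1 := by simp
  set θ : ℝ := angle (x : V) y with hθ
  have hcos : ⟪(x : V), y⟫ = Real.cos θ := inner_eq_cos_angle_of_norm_eq_one hx hy
  set p : V := (y : V) - Real.cos θ • (x : V) with hp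
  have hxp : ⟪(x : V), p⟫ = 0 := by
    rw [hp, inner_sub_right, real_inner_smul_right, hcos, real_inner_self_eq_norm_sq, hx]
    ring
  have hpn : ‖p‖ ^ 2 = Real.sin θ ^ 2 := by
    have h1 : ‖p‖ ^ 2 = ‖(y : V)‖ ^ 2 - 2 * ⟪(y : V), Real.cos θ • (x : V)⟫ +
        ‖Real.cos θ • (x : V)‖ ^ 2 := by
      rw [hp]; exact @norm_sub_sq_real _ _ _ _ _
    rw [h1, real_inner_smul_right, real_inner_comm, hcos, norm_smul, hx, hy, mul_one,
      Real.norm_eq_abs, sq_abs]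
    nlinarith [Real.cos_sq_add_sin_sq θ]
  by_cases hp0 : p = 0
  · obtain ⟨u, hu, hxu⟩ := exists_norm_eq_one_inner_eq_zero_sphere hn x
    refine ⟨u, hu, hxu, ?_⟩
    have hs : Real.sin θ = 0 := by
      have : Real.sin θ ^ 2 = 0 := by rw [← hpn, hp0, norm_zero]; ring
      exact pow_eq_zero_iff two_ne_zero |>.1 this
    rw [hs, zero_smul, add_zero]
    have := hp0
    rwa [hp, sub_eq_zero] at this
  · have hp0' : ‖p‖ ≠ 0 := norm_ne_zero_iff.2 hp0
    refine ⟨‖p‖⁻¹ • p, ?_, ?_, ?_⟩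
    · rw [norm_smul, norm_inv, norm_norm, inv_mul_cancel₀ hp0']
    · rw [real_inner_smul_right, hxp, mul_zero]
    · have hs0 : 0 ≤ Real.sin θ :=
        Real.sin_nonneg_of_nonneg_of_le_pi (angle_nonneg _ _) (angle_le_pi _ _)
      have hsin : ‖p‖ = Real.sin θ := (sq_eq_sq₀ (norm_nonneg _) hs0).1 hpn
      rw [smul_smul, ← hsin, mul_inv_cancel₀ hp0', one_smul, hp]
      abel

/-- **Arc ≤ angle on the round sphere** (`n ≥ 1`): the great circle from `x` to `y` is a `C¹`
path of length `∠(x, y)`, so `d_{g_round}(x, y) ≤ ∠(x, y)`.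
[cite: ONeill1983, Ch. 5, Def. 15 and Ch. 3, p. 57] -/
theorem riemannianEDist_roundSphere_le_ofReal_angle (hn : 1 ≤ n) (x y : sphere (0 : V) 1) :
    letI := (roundMetric (n := n) V).riemannianBundle isRiemannian_roundMetric
    riemannianEDist (𝓡 n) x y ≤ ENNReal.ofReal (angle (x : V) y) := by
  letI := (roundMetric (n := n) V).riemannianBundle isRiemannian_roundMetric
  obtain ⟨u, hu, hxu, hyu⟩ := exists_eq_cos_angle_smul_add_sin_angle_smul_sphere hn x y
  have hx : ‖(x : V)‖ = 1 := by simp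
  set θ : ℝ := angle (x : V) y with hθ
  have hmem : ∀ t, roundGreatCircle (x : V) u θ t ∈ sphere (0 : V) 1 := fun t ↦ by
    simp [norm_roundGreatCircle hx hu hxu]
  set γ : ℝ → sphere (0 : V) 1 := Set.codRestrict (roundGreatCircle (x : V) u θ) _ hmem with hγ
  have hγs : ContMDiff 𝓘(ℝ, ℝ) (𝓡 n) 1 γ :=
    (contMDiff_iff_contDiff.2 (contDiff_roundGreatCircle (x : V) u θ)).codRestrict_sphere hmem
  have h0 : γ 0 = x := Subtype.ext (by simp [γ])
  have h1 : γ 1 = y := Subtype.ext (by simp [γ, hyu])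
  refine (riemannianEDist_le_pathELength hγs.contMDiffOn h0 h1 zero_le_one).trans ?_
  rw [pathELength_eq_lintegral_mfderiv_Icc]
  have hcongr : ∫⁻ t in Icc (0 : ℝ) 1, ‖mfderiv 𝓘(ℝ, ℝ) (𝓡 n) γ t 1‖ₑ =
      ∫⁻ t in Icc (0 : ℝ) 1, ENNReal.ofReal θ := by
    refine setLIntegral_congr_fun measurableSet_Icc fun t _ ↦ ?_
    rw [← ofReal_norm, norm_mfderiv_curve_roundSphere (hγs.mdifferentiableAt one_ne_zero)]
    congr 1
    exact norm_deriv_roundGreatCircle hx hu hxu (angle_nonneg _ _) t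
  rw [hcongr, setLIntegral_const, Real.volume_Icc, sub_zero, ENNReal.ofReal_one, mul_one]

/-- **The Riemannian distance of the round unit sphere is the angle**: for `n ≥ 1` and
`x, y ∈ Sⁿ ⊂ V`, the length distance of the round metric (Mathlib's `riemannianEDist` for the
norms of `g_round`, i.e. the infimum of the lengths of `C¹` paths) is the great-circle distance
`∠(x, y) = arccos ⟪x, y⟫`. (For `n = 0` the sphere is disconnected and the statement fails at
`y = -x`.) [cite: ONeill1983, Ch. 5, Def. 15 and Ch. 3, p. 57] -/
theorem riemannianEDist_roundSphere (hn : 1 ≤ n) (x y : sphere (0 : V) 1) :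
    letI := (roundMetric (n := n) V).riemannianBundle isRiemannian_roundMetric
    riemannianEDist (𝓡 n) x y = ENNReal.ofReal (angle (x : V) y) :=
  le_antisymm (riemannianEDist_roundSphere_le_ofReal_angle hn x y)
    (ofReal_angle_le_riemannianEDist_roundSphere x y)

/-- The same in the vocabulary of `RiemannianDistance.lean`: the Riemannian distance
`(roundMetric V).edist` of the round metric is the angle. [cite: ONeill1983, Ch. 5, Def. 15 and Ch. 3, p. 57] -/
theorem edist_roundMetric (hn : 1 ≤ n) (x y : sphere (0 : V) 1) :
    (roundMetric (n := n) V).edist isRiemannian_roundMetric x y =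
      ENNReal.ofReal (angle (x : V) y) :=
  riemannianEDist_roundSphere hn x y

end RoundSphere

end Literature.Geometry.Riemannian

end
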